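import Summits.BirchSwinnertonDyer.BirchSwinnertonDyer.Theorems.Rank2ObservatoryCertificate
import Summits.BirchSwinnertonDyer.BirchSwinnertonDyer.Theorems.Rank2ObservatoryPointCount
import Summits.BirchSwinnertonDyer.BirchSwinnertonDyer.Theorems.Rank2ObservatoryRank3Exactness
import Literature.NumberTheory.EllipticCurves.BSDRootNumberOddParityProofs
import HarnessLib

/-!
# BirchSwinnertonDyer — rank ≥ 2 observatory: the curve `5077a1` (rank 3)

HONEST FRAMING: per-curve certified theorems and census instruments; no claim on BSD in rank ≥ 2.

Per-curve file of the observatory for Cremona's curve **5077a1**, `y² + y = x³ − 7x + 6`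
(`[a₁,a₂,a₃,a₄,a₆] = [0,0,1,−7,6]`, `N = 5077` prime; the Buhler–Gross–Zagier curve, the rank-3 curve
of smallest conductor). It instantiates `analyticRank_eq_mordellWeilRank_of_rank3Certificate`
(`Rank2ObservatoryCertificate.lean`) with this curve's certificate inputs as NAMED HYPOTHESES
(`hlow`, `hup`, `hL3`, `hw` = certificate fields `rank_lower`, `rank_upper`, `L3`, `root_number`, plus
the tree's Gross–Zagier–Kolyvagin fact `hGZK`), proves the certificate's EXACT vanishing
`L'(E,1) = 0` in the REFEREE R1 shape (`rank3_lderiv_eq_zero_5077a1`, from the tree's named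
Gross–Zagier–Kolyvagin-over-`K` fact with `K = ℚ(√−7)`, the Heegner hypothesis for `(5077, −7)` being
DECIDED in the kernel), and checks IN THE KERNEL: `Δ = 5077`, ellipticity, the three listed generators
on the curve, and `#Ẽ(𝔽_p)` at the torsion-bound and witness primes (`decide` via `affinePointCount`).
Everything below the line "DATA" is recorded provenance, not a theorem.

DATA (two-engine record `certs/rank3/5077a1.json`, schema `bsdr2-rank3-twoengine/v1`,
ISSUE 2, sha256 `4ededb867651e57278314f12b351fbe7237de3bfa68a983c6d514a8e2e416e70`, AGREEMENT-G3 verdict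
GREEN; engine P = cell seat cert-2, PARI/GP + python-flint/Arb, certificate sha256 `eda8bb93…0bbeb21e` (REFEREE
R13 re-emit of farm job `j064174`; the ISSUE-1 record `cae72056…eace00c` embedded the pre-R13 certificate `bddc71cb…c8ccf007`
with the same numbers); engine B = cell seat cert-3, Python standard library only (integer interval arithmetic),
certificate sha256 `b5f388eb…32799d9d` (v0.2.1 re-emit of job `j065961`); no shared library):
* conductor `5077` (P: `ellglobalred`; B: table value, functional equation verified to `2⁻¹⁰⁶`); root
  number `w = −1` (P: `ellrootno`; B: theta-series functional-equation test);
* `L(E,1) = 0` EXACTLY by `w = −1` (both; P also: plus modular symbol `x⁺({0,∞}) = 0`);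
  `L'(E,1) = 0` EXACTLY by Gross–Zagier–Kolyvagin over `K = ℚ(√−7)`: `−7` is a fundamental
  discriminant `≠ −3, −4`, `(−7 / 5077) = +1` (Heegner hypothesis, exact, both engines, and in the
  kernel below), `L(E^{(−7)},1) ∈ 4.476757167764723 ± 1.5·10⁻¹⁵` (B) and a ball excluding `0` from
  PARI `lfun` + the twist's modular symbol (P) — so `L(E^{(−7)},1) ≠ 0`; `rank E(K) ≥ rank E(ℚ) ≥ 3 ≠ 1`;
  `L''(E,1) = 0` by `w = −1` (odd order);
* `L'''(E,1)/3! ∈ [1.731849900119300689791975 ± 8.51·10⁻²⁶]` (P, Arb) and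
  `∈ 1.73184990011930068979197508506015 ± 5.6·10⁻³²` (B, integer intervals, independent `a_p`); the
  balls intersect and exclude `0` (103 agreeing bits); Buhler–Gross–Zagier 1985: `L'''(E,1) ≈ 10.3910994`;
* generators `P₁ = (1,0)`, `P₂ = (2,0)`, `P₃ = (0,2)` (Cremona `allgens`); `E(ℚ)_tors = 0`
  (`gcd_l #Ẽ(𝔽_l) = 1`; kernel: `#Ẽ(𝔽₃) = 7`, `#Ẽ(𝔽₅) = 10`); independence mod torsion: the images of
  the seven non-trivial `𝔽₂`-combinations lie outside `2Ẽ(𝔽_q)` for `q ∈ {5, 7}` (`#Ẽ(𝔽₅) = 10`,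
  `#Ẽ(𝔽₇) = 12`; both engines, identical witness primes, cross-verified in the AGREEMENT step);
* `rank E(ℚ) ≤ 3`: PARI `ellrank(E) = [3, 3, 0, …]` (engine P) and Cremona's `mwrank` (table); engine B
  computes no upper bound (`RANK_UPPER_EXTERNAL`);
* periods: `Ω = 2.0758439915…` (P/B agree to `2⁻¹⁶²`).
A disagreement between the engines on any field would have made this a RED row for the referee and no
file would exist (anomaly protocol).

References: J. P. Buhler, B. H. Gross, D. B. Zagier, Math. Comp. 44 (1985) 473–481 (the curve, its rank
`3`, `L'''(E,1)`); B. H. Gross, LMS LNS 153 (1991), (1.1) and Thm. 1.3; J. E. Cremona, *Algorithms for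
Modular Elliptic Curves* (2nd ed. 1997), §2.13; the certificate theorems of
`Rank2ObservatoryCertificate.lean` and `Rank2ObservatoryRank3Exactness.lean`.
-/

-- single-conjunct summit: `Summit.BirchSwinnertonDyer.BirchSwinnertonDyer.…` repeats the name by design
set_option linter.dupNamespace false

noncomputable section

open scoped Classical

namespace Summit.BirchSwinnertonDyer.BirchSwinnertonDyer.Rank2Observatory

open Literature Literature.NumberTheory.EllipticCurves WeierstrassCurve

/-- The Buhler–Gross–Zagier curve `5077a1`: the (reduced minimal) model `y² + y = x³ − 7x + 6`,
`[a₁,a₂,a₃,a₄,a₆] = [0,0,1,−7,6]` (a uniquely named constant: per-curve files never share a short curve name).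
[cite: BuhlerGrossZagier1985, §1] -/
def curve5077a1 : WeierstrassCurve ℚ := ⟨0, 0, 1, -7, 6⟩

/-- `Δ(5077a1) = 5077` (kernel arithmetic; Buhler–Gross–Zagier 1985, §1: conductor `5077`, prime).
[cite: BuhlerGrossZagier1985, §1] -/
theorem Δ_5077a1 : curve5077a1.Δ = 5077 := by
  norm_num [curve5077a1, WeierstrassCurve.Δ, WeierstrassCurve.b₂, WeierstrassCurve.b₄, WeierstrassCurve.b₆,
    WeierstrassCurve.b₈]

/-- `5077a1` is an elliptic curve (`Δ = 5077 ≠ 0`). [folklore] -/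
instance isElliptic_5077a1 : curve5077a1.IsElliptic := ⟨by rw [Δ_5077a1]; norm_num⟩

/-- The affine equation of `5077a1`: `y² + y = x³ − 7x + 6`. [cite: BuhlerGrossZagier1985, §1] -/
theorem equation_iff_5077a1 (x y : ℚ) :
    curve5077a1.toAffine.Equation x y ↔ y ^ 2 + y = x ^ 3 - 7 * x + 6 := by
  rw [WeierstrassCurve.Affine.equation_iff]
  simp only [curve5077a1]
  constructor <;> intro h <;> linear_combination h

/-- The three listed generators `P₁ = (1,0)`, `P₂ = (2,0)`, `P₃ = (0,2)` (certificate field `rank_lower.points`,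
Cremona `allgens`; Buhler–Gross–Zagier 1985, §1) lie on `5077a1` and are nonsingular points (kernel).
[cite: BuhlerGrossZagier1985, §1] -/
theorem nonsingular_generators_5077a1 :
    curve5077a1.toAffine.Nonsingular 1 0 ∧ curve5077a1.toAffine.Nonsingular 2 0 ∧
      curve5077a1.toAffine.Nonsingular 0 2 :=
  ⟨WeierstrassCurve.Affine.equation_iff_nonsingular.mp ((equation_iff_5077a1 1 0).mpr (by norm_num)),
   WeierstrassCurve.Affine.equation_iff_nonsingular.mp ((equation_iff_5077a1 2 0).mpr (by norm_num)),
   WeierstrassCurve.Affine.equation_iff_nonsingular.mp ((equation_iff_5077a1 0 2).mpr (by norm_num))⟩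

/-- The generator `P₁ = (1,0)` as a point of `E(ℚ)`, `E = 5077a1`. [cite: BuhlerGrossZagier1985, §1] -/
def gen₁_5077a1 : curve5077a1.toAffine.Point := .some (h := nonsingular_generators_5077a1.1)

/-- The generator `P₂ = (2,0)` as a point of `E(ℚ)`, `E = 5077a1`. [cite: BuhlerGrossZagier1985, §1] -/
def gen₂_5077a1 : curve5077a1.toAffine.Point := .some (h := nonsingular_generators_5077a1.2.1)

/-- The generator `P₃ = (0,2)` as a point of `E(ℚ)`, `E = 5077a1`. [cite: BuhlerGrossZagier1985, §1] -/
def gen₃_5077a1 : curve5077a1.toAffine.Point := .some (h := nonsingular_generators_5077a1.2.2)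

/-! ### Kernel re-count of `#Ẽ(𝔽_p)` at the certificate's torsion-bound and witness primes -/

/-- `#Ẽ(𝔽₃) = 7` (`a₃ = −3`): both engines; kernel. [folklore] -/
theorem card_F3_5077a1 : affinePointCount 3 0 0 1 (-7) 6 + 1 = 7 := by decide +kernel

/-- `#Ẽ(𝔽₅) = 10` (`a₅ = −4`): both engines; kernel; a witness prime of both engines. With
`#Ẽ(𝔽₃) = 7` the certificate's torsion bound is `gcd(7, 10) = 1`, so `E(ℚ)_tors = 0` granted
`TORSION_INJECTS`. [folklore] -/
theorem card_F5_5077a1 : affinePointCount 5 0 0 1 (-7) 6 + 1 = 10 := by decide +kernel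

/-- `#Ẽ(𝔽₇) = 12` (`a₇ = −4`): both engines; kernel; the other witness prime of both engines. [folklore] -/
theorem card_F7_5077a1 : affinePointCount 7 0 0 1 (-7) 6 + 1 = 12 := by decide +kernel

/-! ### The per-curve theorems: certificate fields as named hypotheses

* `hlow : 3 ≤ rank_ℤ E(ℚ)` — certificate field `rank_lower` (three listed generators, `2`-saturation
  witnesses at `q = 5, 7`; two engines). A hypothesis: Mathlib has no reduction map `E(ℚ) → Ẽ(𝔽_q)`.
* `hup : rank_ℤ E(ℚ) ≤ 3` — certificate field `rank_upper`: PARI `ellrank(E) = [3, 3, 0, …]` (engine P,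
  `PARI_ELLRANK_2DESCENT`), Cremona's `mwrank` (table).
* `hL3 : L'''(E,1) ≠ 0` — certificate field `L3`: the two certified balls for `L'''(E,1)/3!`, excluding `0`.
* `hw : w(E) = −1` — certificate field `root_number` (P: `ellrootno`; B: functional-equation test).
* `hGZK` — Gross–Zagier–Kolyvagin over `ℚ`, the tree's named fact (bsd.S17); for the exact `L'(E,1) = 0`:
  `hE` (modularity: entire continuation, `hasEntireLFunction_rat`), `hGZKK` (Gross–Zagier + Kolyvagin
  over `K`, `mordellWeilRank_eq_one_of_LDerivEK_ne_zero`), `hmin`/`hN` (the model is globally minimal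
  of conductor `5077`: Tate's algorithm in both engines; `Δ = 5077` is squarefree), `hK`/`hdK` (`K` is
  an imaginary quadratic field of discriminant `−7`), `hLD : L(E^{(−7)},1) ≠ 0` (certificate field
  `heegner.chosen.L_twist_1`, two engines). -/

/-- **`5077a1`: `rank_ℤ E(ℚ) = 3`** from the certificate's two rank fields. [cite: BuhlerGrossZagier1985, §1] -/
theorem mordellWeilRank_5077a1 (hlow : 3 ≤ curve5077a1.mordellWeilRank)
    (hup : curve5077a1.mordellWeilRank ≤ 3) : curve5077a1.mordellWeilRank = 3 :=
  le_antisymm hup hlow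

/-- **`5077a1`: `L(E,1) = 0` exactly**, from the root number `−1` (the tree's PROVED
`entireLFunction_one_eq_zero_of_rootNumber_eq_neg_one`; certificate route `W`).
[cite: BuhlerGrossZagier1985, §2] -/
theorem entireLFunction_one_5077a1 (hw : curve5077a1.rootNumber = -1) :
    curve5077a1.entireLFunction 1 = 0 :=
  entireLFunction_one_eq_zero_of_rootNumber_eq_neg_one hw

/-- **`rank3_lderiv_eq_zero_5077a1`** (REFEREE R1 / R1.L shape) — **`L'(E,1) = 0` EXACTLY** for `5077a1`:
Gross–Zagier–Kolyvagin over the Heegner field `K = ℚ(√−7)` in contrapositive. Inputs by name: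
modularity `hE`, the tree's fact `hGZKK`, the minimal model / conductor (`hmin`, `hN`), `K` imaginary
quadratic of discriminant `−7` (`hK`, `hdK`; the Heegner hypothesis — `5077` is prime and
`(−7 / 5077) = +1`, certificate field `heegner.chosen.heegner_checks` of both engines — is then
DECIDED in the kernel by `norm_num`), the certified rank `hlow`, the twist value
`hLD : L(E^{(−7)},1) ≠ 0`, and the root number `hw` (for `L(E,1) = 0`).
[cite: GrossLMS1991, (1.1) and Thm. 1.3] [cite: BuhlerGrossZagier1985, §2] -/
theorem rank3_lderiv_eq_zero_5077a1 (K : Type) [Field K] [NumberField K]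
    (hE : WeierstrassCurve.hasEntireLFunction_rat)
    (hGZKK : mordellWeilRank_eq_one_of_LDerivEK_ne_zero curve5077a1 K)
    (hmin : curve5077a1.IsGloballyMinimal) (hN : curve5077a1.conductorNorm ℤ = 5077)
    (hK : IsImaginaryQuadratic K) (hdK : NumberField.discr K = -7)
    (hlow : 3 ≤ curve5077a1.mordellWeilRank) (hw : curve5077a1.rootNumber = -1)
    (hLD : (curve5077a1.quadraticTwist (-7 : ℚ)).entireLFunction 1 ≠ 0) :
    deriv curve5077a1.entireLFunction 1 = 0 := by
  haveI := hmin
  have hd : (NumberField.discr K : ℚ) = -7 := by rw [hdK]; norm_num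
  refine deriv_entireLFunction_one_eq_zero_of_kronecker curve5077a1 K (N := 5077) (by norm_num) hN hE
    hGZKK hK ?_ (by omega) (entireLFunction_one_5077a1 hw) (by rw [hd]; exact hLD)
  -- the Heegner hypothesis for (N, D) = (5077, −7): 5077 is prime and (−7/5077) = +1
  intro p hp hpN
  have h5077 : Nat.Prime 5077 := by norm_num
  have hp' : p = 5077 := by
    rcases (Nat.dvd_prime h5077).mp hpN with h | h
    · exact absurd h hp.one_lt.ne'
    · exact h
  subst hp'
  rw [hdK]
  exact ⟨fun h ↦ by omega, fun _ ↦ by norm_num [jacobiSym.mod_left]⟩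

/-- **`analyticRank_eq_rank_5077a1`** — the observatory's per-curve kernel fact for `5077a1`:
`r_an(E) = rank_ℤ E(ℚ)` from Gross–Zagier–Kolyvagin (`hGZK`, bsd.S17) and the four certificate fields
`rank_lower` (`hlow`), `rank_upper` (`hup`), `L3` (`hL3 : L'''(E,1) ≠ 0`;
`L'''(E,1)/3! ∈ [1.731849900119300689791975 ± 8.51·10⁻²⁶] ∩ (1.73184990011930068979197508506015 ± 5.6·10⁻³²)`,
two engines) and `root_number` (`hw : w = −1`), via `analyticRank_eq_mordellWeilRank_of_rank3Certificate`
(two-engine record, ISSUE 2, sha256 `4ededb86…e416e70`). [cite: BuhlerGrossZagier1985, §§1–2] [cite: CremonaAlgorithms1997, §2.13] -/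
theorem analyticRank_eq_rank_5077a1 (hGZK : rank_eq_analyticRank_of_analyticRank_le_one)
    (hlow : 3 ≤ curve5077a1.mordellWeilRank) (hup : curve5077a1.mordellWeilRank ≤ 3)
    (hL3 : iteratedDeriv 3 curve5077a1.entireLFunction 1 ≠ 0) (hw : curve5077a1.rootNumber = -1) :
    curve5077a1.analyticRank = curve5077a1.mordellWeilRank :=
  analyticRank_eq_mordellWeilRank_of_rank3Certificate curve5077a1 hGZK hlow hup hL3 hw

/-- **`5077a1`: `r_an(E) = 3`** under the same hypotheses. [cite: BuhlerGrossZagier1985, §§1–2] -/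
theorem analyticRank_5077a1_eq_three (hGZK : rank_eq_analyticRank_of_analyticRank_le_one)
    (hlow : 3 ≤ curve5077a1.mordellWeilRank) (hup : curve5077a1.mordellWeilRank ≤ 3)
    (hL3 : iteratedDeriv 3 curve5077a1.entireLFunction 1 ≠ 0) (hw : curve5077a1.rootNumber = -1) :
    curve5077a1.analyticRank = 3 := by
  rw [analyticRank_eq_rank_5077a1 hGZK hlow hup hL3 hw, mordellWeilRank_5077a1 hlow hup]

end Summit.BirchSwinnertonDyer.BirchSwinnertonDyer.Rank2Observatory

end
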